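import Literature.Topology.FourManifolds.FramedSphereFamilyOfCharts
import Literature.Topology.FourManifolds.GluckTwistUnknotProofs
import HarnessLib

/-!
# Framed sphere families exist: explicit inhabitants of `FramedSphereFamily (𝓡 4) N ι 2 2`

Topic `Literature/Topology/FourManifolds`; carrier-witness companion (libB census) of
`SphereFamilySurgery.lean`.  `Literature.Topology.FourManifolds.FramedSphereFamily IX X ι k m`
(Milnor 1965, PDF p. 21: *"disjoint characteristic embeddings `φᵢ : S^{λᵢ-1} × OD^{n-λᵢ} → V`"*)
is the carrier over which the h-cobordism / cork routes of the `SmoothPoincare4` summit quantify,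
always as `FramedSphereFamily (𝓡 4) N ι 2 2` (`N` a smooth 4-manifold charted on `ℝ⁴`, `ι = Fin k`
or `Unit`: disjoint framed 2-spheres in a 4-manifold).  This file decides its inhabitation;
everything is a definition or proved, there are no named facts.

* `Literature.Topology.FourManifolds.FramedSphereFamily_nonempty`: for every **nonempty** `C^∞`
  4-manifold `N` (`ChartedSpace (𝔼 4) N`, `IsManifold (𝓡 4) ∞ N`) and every **countable** `ι`
  the type `FramedSphereFamily (𝓡 4) N ι 2 2` is inhabited, by the explicit family
  `SphereFamilyWitness.chartTubes x₀ ι`: the standard open tubular neighbourhood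
  `S² × ℝ² ≅ {y ≠ 0} ⊆ S⁴ ⊆ ℝ³ × ℝ²` of the unknotted 2-sphere (`GluckUnknot.tubeHomeomorph`,
  `GluckTwistUnknotProofs.lean`; Kirby 1989, PDF p. 14: *"Given a smoothly knotted 2-sphere `Θ` in
  `S⁴`, remove its tubular neighborhood `S² × B²` …"*), read in `ℝ⁴` through a stereographic
  chart, squeezed into the pairwise disjoint unit balls `B(3n·e₀, 1)`, `n ∈ ℕ`, by Mathlib's
  diffeomorphisms `OpenPartialHomeomorph.univBall`, transplanted into a chart ball of `N` at `x₀`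
  (`FramedSphereFamily.ofChartsEuclidean`, `FramedSphereFamilyOfCharts.lean`), re-indexed along
  `ι ↪ ℕ`; instances `FramedSphereFamily.instNonempty`, `FramedSphereFamily.instNonemptySphereFour`
  serve the census shapes `ι = Fin k, Unit, ℕ` over any nonempty `N`, over `ℝ⁴` and over `S⁴`.
* The exact region (all `IX, k, m`): `FramedSphereFamily.isEmpty_of_isEmpty` (`N` empty, `ι`
  nonempty), `FramedSphereFamily.isEmpty_of_not_countable` (`ι` uncountable, `N` separable: the
  ranges are nonempty, open, pairwise disjoint), `FramedSphereFamily.empty` (`ι` empty); whence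
  `FramedSphereFamily_nonempty_iff`: over a second-countable `C^∞` 4-manifold `N`,
  `Nonempty (FramedSphereFamily (𝓡 4) N ι 2 2) ↔ IsEmpty ι ∨ (Nonempty N ∧ Countable ι)`.

## References

* J. Milnor, *Lectures on the h-cobordism theorem*, Princeton (1965), Def. 3.9 (PDF p. 16),
  §3 (PDF p. 21). [MilnorHCobordism1965]
* R. C. Kirby, *The topology of 4-manifolds*, LNM 1374 (1989), Ch. I §6 (PDF p. 14 of the held
  copy `book:kirby1989-topology-4-manifolds`). [Kirby1989]
-/

open scoped Manifold ContDiff Topology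
open Set Function Metric

noncomputable section

namespace Literature.Topology.FourManifolds

universe u v

/-- Local notation: `𝔼 n` is the model Euclidean space `EuclideanSpace ℝ (Fin n)`. -/
local notation "𝔼 " n:arg => EuclideanSpace ℝ (Fin n)

/-- Local notation: `𝕊 n` is the unit sphere in `EuclideanSpace ℝ (Fin (n + 1))`. -/
local notation "𝕊 " n:arg => (Metric.sphere (0 : EuclideanSpace ℝ (Fin (n + 1))) 1)

/-! ### Generalities: the empty family, sub-families, necessary conditions -/

namespace FramedSphereFamily

section General

variable {EX HX : Type*} [NormedAddCommGroup EX] [NormedSpace ℝ EX] [TopologicalSpace HX]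
  {IX : ModelWithCorners ℝ EX HX} {X : Type*} [TopologicalSpace X] [ChartedSpace HX X]
  {ι : Type u} {k m : ℕ}

/-- The base point `e₀ = (1, 0, …, 0)` of the unit sphere `Sᵏ`. [folklore] -/
def basePoint (k : ℕ) : 𝕊 k := ⟨EuclideanSpace.single 0 1, by simp⟩

variable (IX X ι k m) in
/-- **The empty framed family** (no spheres at all): the inhabitant of
`FramedSphereFamily IX X ι k m` for an empty index type `ι`, in any manifold `X`. [folklore] -/
def empty [IsEmpty ι] : FramedSphereFamily IX X ι k m where
  toFun i := isEmptyElim i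
  isSmoothEmbedding i := isEmptyElim i
  isOpen_range i := isEmptyElim i
  disjoint_range i := isEmptyElim i

/-- For an empty index type the carrier is inhabited by the empty family. [folklore] -/
instance instNonemptyOfIsEmpty [IsEmpty ι] : Nonempty (FramedSphereFamily IX X ι k m) :=
  ⟨empty IX X ι k m⟩

/-- **Sub-families**: re-indexing a framed family along an injection `f : ι' ↪ ι` (keep the
spheres `φ_{f j}`); disjointness is inherited because `f` is injective. [folklore] -/
def reindex (ν : FramedSphereFamily IX X ι k m) {ι' : Type v} (f : ι' → ι) (hf : Injective f) :
    FramedSphereFamily IX X ι' k m where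
  toFun j := ν.toFun (f j)
  isSmoothEmbedding j := ν.isSmoothEmbedding (f j)
  isOpen_range j := ν.isOpen_range (f j)
  disjoint_range _ _ h := ν.disjoint_range (hf.ne h)

/-- The embeddings of a re-indexed family. [folklore] -/
@[simp] theorem reindex_toFun (ν : FramedSphereFamily IX X ι k m) {ι' : Type v} (f : ι' → ι)
    (hf : Injective f) (j : ι') : (ν.reindex f hf).toFun j = ν.toFun (f j) := rfl

/-- The core spheres of a re-indexed family. [folklore] -/
@[simp] theorem sphere_reindex (ν : FramedSphereFamily IX X ι k m) {ι' : Type v} (f : ι' → ι)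
    (hf : Injective f) (j : ι') : (ν.reindex f hf).sphere j = ν.sphere (f j) := rfl

/-- A manifold carrying a framed family with nonempty index type contains `φᵢ(e₀, 0)`. [folklore] -/
theorem nonempty_space (ν : FramedSphereFamily IX X ι k m) [Nonempty ι] : Nonempty X :=
  ⟨ν.toFun (Classical.arbitrary ι) (basePoint k, 0)⟩

/-- **The index type of a framed family in a separable manifold is countable**: the tubes
`φᵢ(Sᵏ × ℝᵐ) ∋ φᵢ(e₀, 0)` are nonempty, open and pairwise disjoint. [folklore] -/
theorem countable_index [TopologicalSpace.SeparableSpace X] (ν : FramedSphereFamily IX X ι k m) :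
    Countable ι :=
  ν.disjoint_range.countable_of_isOpen_disjoint ν.isOpen_range
    fun _ => ⟨_, mem_range_self (basePoint k, 0)⟩

variable (IX X ι k m) in
/-- **Emptiness region, I.** In an empty manifold there is no framed family with a nonempty
index type. [folklore] -/
theorem isEmpty_of_isEmpty [IsEmpty X] [Nonempty ι] : IsEmpty (FramedSphereFamily IX X ι k m) :=
  ⟨fun ν => ν.nonempty_space.elim fun x => isEmptyElim x⟩

variable (IX X ι k m) in
/-- **Emptiness region, II.** In a separable manifold there is no framed family with an
uncountable index type. [folklore] -/
theorem isEmpty_of_not_countable [TopologicalSpace.SeparableSpace X] (h : ¬Countable ι) :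
    IsEmpty (FramedSphereFamily IX X ι k m) :=
  ⟨fun ν => h ν.countable_index⟩

end General

end FramedSphereFamily

/-! ### Compositions of partial diffeomorphisms -/

namespace SphereFamilyWitness

section Trans

variable {EA HA EB HB EC HC A B C : Type*} [NormedAddCommGroup EA] [NormedSpace ℝ EA]
  [TopologicalSpace HA] {IA : ModelWithCorners ℝ EA HA} [NormedAddCommGroup EB] [NormedSpace ℝ EB]
  [TopologicalSpace HB] {IB : ModelWithCorners ℝ EB HB} [NormedAddCommGroup EC] [NormedSpace ℝ EC]
  [TopologicalSpace HC] {IC : ModelWithCorners ℝ EC HC} [TopologicalSpace A] [ChartedSpace HA A]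
  [TopologicalSpace B] [ChartedSpace HB B] [TopologicalSpace C] [ChartedSpace HC C]

/-- A composition of open partial homeomorphisms `C^∞` on their sources is `C^∞` on its source.
[folklore] -/
theorem contMDiffOn_trans {e : OpenPartialHomeomorph A B} {e' : OpenPartialHomeomorph B C}
    (he : ContMDiffOn IA IB ∞ e e.source) (he' : ContMDiffOn IB IC ∞ e' e'.source) :
    ContMDiffOn IA IC ∞ (e.trans e') (e.trans e').source := by
  rw [OpenPartialHomeomorph.coe_trans, OpenPartialHomeomorph.trans_source]
  exact he'.comp' he

/-- The inverse of the composition of two open partial homeomorphisms with `C^∞` inverses (on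
their targets) is `C^∞` on its target. [folklore] -/
theorem contMDiffOn_trans_symm {e : OpenPartialHomeomorph A B} {e' : OpenPartialHomeomorph B C}
    (he : ContMDiffOn IB IA ∞ e.symm e.target) (he' : ContMDiffOn IC IB ∞ e'.symm e'.target) :
    ContMDiffOn IC IA ∞ (e.trans e').symm (e.trans e').target := by
  rw [OpenPartialHomeomorph.coe_trans_symm, OpenPartialHomeomorph.trans_target]
  exact he.comp' he'

end Trans

/-- Mathlib's diffeomorphism `univBall c r : ℝ⁴ ≅ B(c, r)` (`r > 0`) has a `C^∞` inverse on its
target, in manifold language. [folklore] -/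
theorem contMDiffOn_univBall_symm (c : 𝔼 4) {r : ℝ} (hr : 0 < r) :
    ContMDiffOn (𝓡 4) (𝓡 4) ∞ (OpenPartialHomeomorph.univBall c r).symm
      (OpenPartialHomeomorph.univBall c r).target := by
  rw [OpenPartialHomeomorph.univBall_target c hr]
  exact OpenPartialHomeomorph.contDiffOn_univBall_symm.contMDiffOn

/-! ### The standard tube `S² × ℝ² ↪ ℝ⁴` and its disjoint copies -/

/-- `finrank ℝ ℝ⁵ = 4 + 1` (spelling `Fin (4 + 1)`), for Mathlib's sphere API on `𝕊 4`. [folklore] -/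
private theorem fact_finrank_four_add_one :
    Fact (Module.finrank ℝ (EuclideanSpace ℝ (Fin (4 + 1))) = 4 + 1) :=
  ⟨finrank_euclideanSpace_fin⟩

attribute [local instance] fact_finrank_four_add_one
open GluckUnknot

/-- The point `(0, 0, 0, 1, 0) ∈ S⁴`, on the circle `{y = 0}` missed by the tube of the unknotted
2-sphere; the stereographic chart of `S⁴` at this point is defined on all of that tube. [folklore] -/
def pole : 𝕊 4 := ⟨EuclideanSpace.single 3 1, by simp⟩

/-- The tube of the unknotted 2-sphere lies in the source `{-pole}ᶜ` of the chart of `S⁴` at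
`pole` (the `ℝ³`-component of `-pole` vanishes, that of a tube point does not). [folklore] -/
theorem tube_mem_chartAt_source (q : (𝕊 2) × 𝔼 2) : tube q ∈ (chartAt (𝔼 4) pole).source := by
  have h : (chartAt (𝔼 4) pole).source = {-pole}ᶜ := stereographic'_source (-pole)
  have h0 : headThree ((-pole : 𝕊 4) : EuclideanSpace ℝ (Fin (4 + 1))) = 0 := by
    ext i
    fin_cases i <;> simp [pole, headThree]
  rw [h, mem_compl_iff, mem_singleton_iff]
  intro hq
  have h1 := headThree_tubeVec_ne_zero q
  rw [← coe_tube, hq, h0] at h1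
  exact h1 rfl

/-- **The standard tube in `ℝ⁴`**: the tube `S² × ℝ² ≅ {y ≠ 0} ⊆ S⁴` of the unknotted 2-sphere
followed by the stereographic chart of `S⁴` at `pole`, as `S² × ℝ² ⇀ ℝ⁴`. [folklore] -/
def euclidTube : OpenPartialHomeomorph ((𝕊 2) × 𝔼 2) (𝔼 4) :=
  tubeHomeomorph.trans (chartAt (𝔼 4) pole)

/-- The standard tube in `ℝ⁴` is globally defined. [folklore] -/
theorem euclidTube_source : euclidTube.source = univ := by
  rw [euclidTube, OpenPartialHomeomorph.trans_source, tubeHomeomorph_source, univ_inter,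
    eq_univ_iff_forall]
  exact tube_mem_chartAt_source

/-- The standard tube in `ℝ⁴` is `C^∞` on its source. [folklore] -/
theorem contMDiffOn_euclidTube :
    ContMDiffOn ((𝓡 2).prod 𝓘(ℝ, 𝔼 2)) (𝓡 4) ∞ euclidTube euclidTube.source :=
  contMDiffOn_trans contMDiff_tube.contMDiffOn contMDiffOn_chart

/-- The inverse of the standard tube in `ℝ⁴` is `C^∞` on its target. [folklore] -/
theorem contMDiffOn_euclidTube_symm :
    ContMDiffOn (𝓡 4) ((𝓡 2).prod 𝓘(ℝ, 𝔼 2)) ∞ euclidTube.symm euclidTube.target :=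
  contMDiffOn_trans_symm contMDiffOn_tubeInv contMDiffOn_chart_symm

/-- **The standard tube squeezed into the unit ball `B(c, 1)`** of `ℝ⁴` by Mathlib's
diffeomorphism `OpenPartialHomeomorph.univBall c 1 : ℝ⁴ ≅ B(c, 1)`. [folklore] -/
def ballTube (c : 𝔼 4) : OpenPartialHomeomorph ((𝕊 2) × 𝔼 2) (𝔼 4) :=
  euclidTube.trans (OpenPartialHomeomorph.univBall c 1)

/-- The squeezed tube is globally defined. [folklore] -/
theorem ballTube_source (c : 𝔼 4) : (ballTube c).source = univ := by
  rw [ballTube, OpenPartialHomeomorph.trans_source, euclidTube_source,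
    OpenPartialHomeomorph.univBall_source, preimage_univ, univ_inter]

/-- The squeezed tube is `C^∞` on its source. [folklore] -/
theorem contMDiffOn_ballTube (c : 𝔼 4) :
    ContMDiffOn ((𝓡 2).prod 𝓘(ℝ, 𝔼 2)) (𝓡 4) ∞ (ballTube c) (ballTube c).source :=
  contMDiffOn_trans contMDiffOn_euclidTube
    OpenPartialHomeomorph.contDiff_univBall.contMDiff.contMDiffOn

/-- The inverse of the squeezed tube is `C^∞` on its target. [folklore] -/
theorem contMDiffOn_ballTube_symm (c : 𝔼 4) :
    ContMDiffOn (𝓡 4) ((𝓡 2).prod 𝓘(ℝ, 𝔼 2)) ∞ (ballTube c).symm (ballTube c).target :=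
  contMDiffOn_trans_symm contMDiffOn_euclidTube_symm (contMDiffOn_univBall_symm c one_pos)

/-- The squeezed tube lands in the ball `B(c, 1)`. [folklore] -/
theorem ballTube_target_subset (c : 𝔼 4) : (ballTube c).target ⊆ ball c 1 := by
  rw [ballTube, OpenPartialHomeomorph.trans_target, OpenPartialHomeomorph.univBall_target c one_pos]
  exact inter_subset_left

/-- The centres `3n · e₀ ∈ ℝ⁴`, `n ∈ ℕ`, of the disjoint balls receiving the copies of the tube.
[folklore] -/
def center (n : ℕ) : 𝔼 4 := (3 * (n : ℝ)) • EuclideanSpace.single 0 1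

/-- Distinct centres are at distance `≥ 2` (in fact `3 |n - n'| ≥ 3`). [folklore] -/
theorem two_le_dist_center {n n' : ℕ} (h : n ≠ n') : 2 ≤ dist (center n) (center n') := by
  have h0 : ‖(EuclideanSpace.single 0 1 : 𝔼 4)‖ = 1 := by simp
  have hz : (1 : ℤ) ≤ |(n : ℤ) - n'| := Int.one_le_abs (sub_ne_zero.2 (by exact_mod_cast h))
  have hr : (1 : ℝ) ≤ |(n : ℝ) - n'| := by exact_mod_cast hz
  rw [center, center, dist_eq_norm, ← sub_smul, norm_smul, h0, mul_one, ← mul_sub, norm_mul,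
    Real.norm_eq_abs, Real.norm_eq_abs, abs_of_pos (by norm_num : (0 : ℝ) < 3)]
  linarith

/-- The unit balls about distinct centres are disjoint. [folklore] -/
theorem disjoint_ball_center {n n' : ℕ} (h : n ≠ n') :
    Disjoint (ball (center n) 1) (ball (center n') 1) :=
  ball_disjoint_ball (by norm_num; exact two_le_dist_center h : (1 : ℝ) + 1 ≤ dist (center n) (center n'))

/-! ### Transplanting into a chart of a 4-manifold -/

section Chart

variable {N : Type*} [TopologicalSpace N] [ChartedSpace (𝔼 4) N]

/-- A radius `ε(x₀) > 0` with `B(chart x₀, ε) ⊆` the (open) target of the chart at `x₀`.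
[folklore] -/
def chartRadius (x₀ : N) : ℝ :=
  (Metric.isOpen_iff.1 (chartAt (𝔼 4) x₀).open_target _ (mem_chart_target _ x₀)).choose

/-- The chart radius is positive and the chart ball lies in the target of the chart. [folklore] -/
theorem chartRadius_spec (x₀ : N) : 0 < chartRadius x₀ ∧
    ball (chartAt (𝔼 4) x₀ x₀) (chartRadius x₀) ⊆ (chartAt (𝔼 4) x₀).target :=
  (Metric.isOpen_iff.1 (chartAt (𝔼 4) x₀).open_target _ (mem_chart_target _ x₀)).choose_spec

/-- **The tube transplanted into `N`**: the copy of the standard tube in the unit ball `B(c, 1)`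
of `ℝ⁴`, squeezed into the chart ball `B(chart x₀, ε(x₀))` and pulled back to `N` by the inverse
chart at `x₀` — an open partial homeomorphism `S² × ℝ² ⇀ N`. [folklore] -/
def chartTube (x₀ : N) (c : 𝔼 4) : OpenPartialHomeomorph ((𝕊 2) × 𝔼 2) N :=
  ((ballTube c).trans
    (OpenPartialHomeomorph.univBall (chartAt (𝔼 4) x₀ x₀) (chartRadius x₀))).trans
    (chartAt (𝔼 4) x₀).symm

/-- The transplanted tube is globally defined. [folklore] -/
theorem chartTube_source (x₀ : N) (c : 𝔼 4) : (chartTube x₀ c).source = univ := by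
  rw [chartTube, OpenPartialHomeomorph.trans_source, OpenPartialHomeomorph.trans_source,
    ballTube_source, OpenPartialHomeomorph.univBall_source, preimage_univ, univ_inter, univ_inter,
    eq_univ_iff_forall]
  intro q
  rw [mem_preimage, OpenPartialHomeomorph.symm_source, OpenPartialHomeomorph.coe_trans]
  apply (chartRadius_spec x₀).2
  rw [← OpenPartialHomeomorph.univBall_target _ (chartRadius_spec x₀).1]
  exact OpenPartialHomeomorph.map_source _
    (by rw [OpenPartialHomeomorph.univBall_source]; exact mem_univ _)

/-- Tubes transplanted from disjoint unit balls have disjoint targets. [folklore] -/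
theorem disjoint_chartTube_target (x₀ : N) {c c' : 𝔼 4} (h : Disjoint (ball c 1) (ball c' 1)) :
    Disjoint (chartTube x₀ c).target (chartTube x₀ c').target := by
  rw [disjoint_left]
  intro z hz hz'
  rw [chartTube, OpenPartialHomeomorph.trans_target, OpenPartialHomeomorph.trans_target] at hz hz'
  exact disjoint_left.1 h (ballTube_target_subset c hz.2.2) (ballTube_target_subset c' hz'.2.2)

variable [IsManifold (𝓡 4) ∞ N]

/-- The transplanted tube is `C^∞`. [folklore] -/
theorem contMDiff_chartTube (x₀ : N) (c : 𝔼 4) :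
    ContMDiff ((𝓡 2).prod 𝓘(ℝ, 𝔼 2)) (𝓡 4) ∞ (chartTube x₀ c) := by
  rw [← contMDiffOn_univ, ← chartTube_source x₀ c]
  exact contMDiffOn_trans (contMDiffOn_trans (contMDiffOn_ballTube c)
    OpenPartialHomeomorph.contDiff_univBall.contMDiff.contMDiffOn) contMDiffOn_chart_symm

/-- The inverse of the transplanted tube is `C^∞` on its target. [folklore] -/
theorem contMDiffOn_chartTube_symm (x₀ : N) (c : 𝔼 4) :
    ContMDiffOn (𝓡 4) ((𝓡 2).prod 𝓘(ℝ, 𝔼 2)) ∞ (chartTube x₀ c).symm (chartTube x₀ c).target := by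
  have h2 : ContMDiffOn (𝓡 4) (𝓡 4) ∞ (chartAt (𝔼 4) x₀).symm.symm
      (chartAt (𝔼 4) x₀).symm.target := by
    rw [OpenPartialHomeomorph.symm_symm]
    exact contMDiffOn_chart
  exact contMDiffOn_trans_symm (contMDiffOn_trans_symm (contMDiffOn_ballTube_symm c)
    (contMDiffOn_univBall_symm _ (chartRadius_spec x₀).1)) h2

/-- **Countably many disjoint framed 2-spheres in any nonempty 4-manifold**: the tubes
transplanted from the disjoint unit balls `B(3n·e₀, 1)`, `n ∈ ℕ`, of `ℝ⁴` into the chart at `x₀`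
form a framed sphere family `ℕ × S² × ℝ² ↪ N` (Milnor's *"disjoint characteristic embeddings"*,
here of trivially embedded 2-spheres inside one coordinate ball).
[cite: MilnorHCobordism1965, §3 (PDF p. 21)] -/
def chartTubesNat (x₀ : N) : FramedSphereFamily (𝓡 4) N ℕ 2 2 :=
  FramedSphereFamily.ofChartsEuclidean (n := 4) (k := 2) (m := 2) (by norm_num)
    (fun n => chartTube x₀ (center n)) (fun n => chartTube_source x₀ (center n))
    (fun n => contMDiff_chartTube x₀ (center n)) (fun n => contMDiffOn_chartTube_symm x₀ (center n))
    fun _ _ h => disjoint_chartTube_target x₀ (disjoint_ball_center h)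

/-- **A framed family of disjoint 2-spheres indexed by any countable type** in a nonempty
4-manifold: the sub-family of `chartTubesNat x₀` along an injection `ι ↪ ℕ`.
[cite: MilnorHCobordism1965, §3 (PDF p. 21)] -/
def chartTubes (x₀ : N) (ι : Type u) [Countable ι] : FramedSphereFamily (𝓡 4) N ι 2 2 :=
  (chartTubesNat x₀).reindex _ (Classical.choose_spec (Countable.exists_injective_nat ι))

end Chart

end SphereFamilyWitness

/-! ### The carrier is inhabited -/

section Main

variable (N : Type*) [TopologicalSpace N] [ChartedSpace (𝔼 4) N] [IsManifold (𝓡 4) ∞ N]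

/-- **`FramedSphereFamily (𝓡 4) N ι 2 2` is inhabited** for every nonempty `C^∞` 4-manifold `N`
charted on `ℝ⁴` and every countable index type `ι` (in particular `Fin k`, `Unit`, `ℕ`): witness
`SphereFamilyWitness.chartTubes x₀ ι`, countably many disjoint copies of the standard tube
`S² × ℝ²` of the unknotted 2-sphere inside one coordinate ball.
[cite: MilnorHCobordism1965, §3 (PDF p. 21)] -/
theorem FramedSphereFamily_nonempty [Nonempty N] (ι : Type u) [Countable ι] :
    Nonempty (FramedSphereFamily (𝓡 4) N ι 2 2) :=
  ⟨SphereFamilyWitness.chartTubes (Classical.arbitrary N) ι⟩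

/-- Instance form of `FramedSphereFamily_nonempty`. [folklore] -/
instance FramedSphereFamily.instNonempty [Nonempty N] (ι : Type u) [Countable ι] :
    Nonempty (FramedSphereFamily (𝓡 4) N ι 2 2) :=
  FramedSphereFamily_nonempty N ι

/-- **The exact inhabitation region** of the carrier over a second-countable `C^∞` 4-manifold:
`FramedSphereFamily (𝓡 4) N ι 2 2` is inhabited iff `ι` is empty, or `N` is nonempty and `ι`
countable. [folklore] -/
theorem FramedSphereFamily_nonempty_iff [SecondCountableTopology N] (ι : Type u) :
    Nonempty (FramedSphereFamily (𝓡 4) N ι 2 2) ↔ IsEmpty ι ∨ (Nonempty N ∧ Countable ι) := by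
  constructor
  · rintro ⟨ν⟩
    rcases isEmpty_or_nonempty ι with h | h
    · exact Or.inl h
    · exact Or.inr ⟨ν.nonempty_space, ν.countable_index⟩
  · rintro (h | ⟨⟨x₀⟩, h⟩)
    · exact ⟨FramedSphereFamily.empty _ _ _ _ _⟩
    · exact ⟨SphereFamilyWitness.chartTubes x₀ ι⟩

/-- **Emptiness region**: over a second-countable `C^∞` 4-manifold the carrier is empty iff `ι`
is nonempty and (`N` is empty or `ι` is uncountable). [folklore] -/
theorem FramedSphereFamily_isEmpty_iff [SecondCountableTopology N] (ι : Type u) :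
    IsEmpty (FramedSphereFamily (𝓡 4) N ι 2 2) ↔ Nonempty ι ∧ (IsEmpty N ∨ ¬Countable ι) := by
  rw [← not_nonempty_iff, FramedSphereFamily_nonempty_iff, not_or, not_and_or, not_isEmpty_iff,
    not_nonempty_iff]

-- The example domains of the census, `FramedSphereFamily (𝓡 4) N (Fin k) 2 2` and `… Unit 2 2`:
example [Nonempty N] (k : ℕ) : Nonempty (FramedSphereFamily (𝓡 4) N (Fin k) 2 2) := inferInstance
example [Nonempty N] : Nonempty (FramedSphereFamily (𝓡 4) N Unit 2 2) := inferInstance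

/-- **In `S⁴` itself**: disjoint framed 2-spheres indexed by any countable type (e.g. `Fin k`),
inside one coordinate ball about the point `(0, 0, 0, 1, 0)`; registered as an instance because
Mathlib has no `Nonempty` instance for round spheres, so `FramedSphereFamily.instNonempty` does
not fire on `S⁴`. [folklore] -/
instance FramedSphereFamily.instNonemptySphereFour (ι : Type u) [Countable ι] :
    Nonempty (FramedSphereFamily (𝓡 4) (𝕊 4) ι 2 2) :=
  ⟨SphereFamilyWitness.chartTubes SphereFamilyWitness.pole ι⟩

end Main

end Literature.Topology.FourManifolds

end
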